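import Literature.NumberTheory.PAdicHodge.EisensteinFormalLogCoordinates
import Literature.NumberTheory.EllipticCurves.FormalLogExpBaseChangeProofs
import Summits.BirchSwinnertonDyer.BirchSwinnertonDyer.Theorems.CyclotomicUntwistKatzDieudonneRankHolds
import HarnessLib

/-!
# The transported Hodge line: `log_{W_D} ≡ A·log_{E₀} + B·log_{E₀}(Xᵖ)` modulo bounded series, for a Weierstrass curve
# `W_D` over the RAMIFIED ring `𝒪_D = ℤ_p[ϖ]` congruent mod `ϖ` to a curve `E₀/ℤ` with good reduction at `p` (`p` odd)

Cell `pub/bsd-wall`, D-0145 line `route-BirchSwinnertonDyer-EdixhovenFibreFiveSeven`, seat `bsd-line-edix-p1` (gen 26); crux K★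
`stmt-BirchSwinnertonDyer-22226` (`StarredOptimalManinUnitFiveSeven`), line `kato_lever`, memo `Cruxes/StarredOptimalManinUnitFiveSeven/Lines/
kato-lever-K2-ramified-cm-transport.md` §8 «Hodge line». THEOREMS ONLY (no definition, no named fact, no instance, no `sorry`); helper
`--supports stmt-BirchSwinnertonDyer-22226`. **BSD is not proved by this file, and neither is K★**: what it proves is a statement about formal
groups over `ℤ_p[ϖ]`.

THE STATEMENT (`exists_transportedHodgeLine`). Let `F` be a `p`-adic field, `D` an Eisenstein root datum (`𝒪_D = ℤ_p[ϖ]`, `e = [ℚ_p(ϖ):ℚ_p]`),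
`φ_D : 𝒪_D → ℂ_F`, `W/𝒪_D` a Weierstrass curve with `W ≡ E₀ (mod ϖ)` for some `E₀/ℤ` whose fibres `E₀ ⊗ ℚ_p`, `E₀ ⊗ 𝔽_p` are elliptic, `p ≠ 2`,
and `‖ϖ‖ʲ ≤ M‖j‖` (`j ≥ 1`). Then there are `a₀,…,a_{e−1}, b₀,…,b_{e−1} ∈ ℚ_p` and `d ∈ ℕ` with, for `A = Σ aᵢϖⁱ`, `B = Σ bᵢϖⁱ ∈ L = ℚ_p(ϖ)`,
**`‖p^d · [Xⁿ](log_{W ⊗ ℂ_F} − A·log_{E₀} − B·log_{E₀}(Xᵖ))‖ ≤ 1` for all `n`** — the class of `log_W` in Katz's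
`D(Ê₀ ⊗ 𝒪_D/𝒪_D) ⊗ ℚ = L·[log_{E₀}] ⊕ L·[log_{E₀}(Xᵖ)]` has coordinates `(A, B)`: the Hodge line of `W` transported to the Dieudonné module of the
CM/good fibre `E₀`.

THE PROOF. `EisensteinFormalLogCoordinates.exists_coords_formalLog_secondKind` (edix-p1 g26): `log_W = Σ_{i<e} ϖⁱ·ι_*ℓᵢ` with `ℓᵢ ∈ ℚ_p⟦X⟧` log-type
and of the second kind for `F_{E₀}` (coboundary bounded by `M/‖p‖`); the tree's KERNEL theorem `KatzRankAllFibres.padicRankTwo` (cycu seats,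
Katz 1981 Thm. 5.3.3 on every good fibre, `p` odd) gives `ℓᵢ ≡ aᵢ·log_{E₀} + bᵢ·log_{E₀}(Xᵖ)` mod `p^{−dᵢ}`-bounded; reassemble with
`‖Σ ϖⁱ ι(cᵢ)‖ ≤ max ‖cᵢ‖` (ultrametric) and `d = Σ dᵢ`.

References: [cite: Katz1981CrystallineDieudonne, Thm. 5.1.4, Thm. 5.3.3] · [cite: Honda1970, Thm. 2] · [cite: SerreLocalFields1979, Ch. I §6 Prop. 18] ·
[cite: SilvermanAEC2009, IV.5.5].
-/

set_option autoImplicit false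
-- single-conjunct summit: `Summit.BirchSwinnertonDyer.BirchSwinnertonDyer.…` repeats the name by design
set_option linter.dupNamespace false

noncomputable section

open scoped Classical
open ValuativeRel Field Literature.NumberTheory.PAdicHodge
  Literature.NumberTheory.GaloisRepresentations Literature.NumberTheory.GaloisRepresentations.IsNonarchimedeanLocalField

namespace Summit.BirchSwinnertonDyer.BirchSwinnertonDyer.Theorems.TransportedHodgeLine

variable {F : Type} [Field F] [ValuativeRel F] [TopologicalSpace F] [IsNonarchimedeanLocalField F] [CharZero F]
  {p : ℕ} [hpp : Fact p.Prime] {hp : valuation F p < 1} (D : EisensteinRoot F p hp) [CharZero (CompletedAlgClosure F)]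

/-- ★★★ **The transported Hodge line.** For `W/𝒪_D` (`𝒪_D = ℤ_p[ϖ]`) with `W ≡ E₀ (mod ϖ)`, `E₀/ℤ` with elliptic fibres over `ℚ_p` and `𝔽_p`,
`p ≠ 2`, and `‖ϖ‖ʲ ≤ M‖j‖` (`j ≥ 1`): there are `aᵢ, bᵢ ∈ ℚ_p` (`i < e`) and `d` with
`‖p^d·[Xⁿ](log_{W ⊗ ℂ_F} − (Σ aᵢϖⁱ)·log_{E₀} − (Σ bᵢϖⁱ)·log_{E₀}(Xᵖ))‖ ≤ 1` for every `n` — `log_W ≡ A·log_{E₀} + B·φ*log_{E₀}` in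
`D(Ê₀ ⊗ 𝒪_D) ⊗ ℚ` with `A, B ∈ ℚ_p(ϖ)`. [cite: Katz1981CrystallineDieudonne, Thm. 5.1.4, Thm. 5.3.3] [cite: Honda1970, Thm. 2] -/
theorem exists_transportedHodgeLine (hp2 : p ≠ 2) (W : WeierstrassCurve (EisensteinRoot.CoeffDisc D)) (E₀ : WeierstrassCurve ℤ)
    [((E₀.map (Int.castRingHom ℤ_[p])).map PadicInt.Coe.ringHom).IsElliptic]
    [((E₀.map (Int.castRingHom ℤ_[p])).map PadicInt.toZMod).IsElliptic]
    (hWE : W.map (Ideal.Quotient.mk (Ideal.span {EisensteinRoot.CoeffDisc.of D (AdjoinRoot.root D.poly)})) =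
      (E₀.map (algebraMap ℤ (EisensteinRoot.CoeffDisc D))).map
        (Ideal.Quotient.mk (Ideal.span {EisensteinRoot.CoeffDisc.of D (AdjoinRoot.root D.poly)})))
    {M : ℝ} (hM0 : 0 ≤ M) (hM : ∀ j : ℕ, 1 ≤ j → ‖((D.rootC : integerC F) : CompletedAlgClosure F)‖ ^ j ≤ M * ‖(j : CompletedAlgClosure F)‖) :
    ∃ (a b : Fin D.e → PadicBase F p hp) (d : ℕ), ∀ n : ℕ,
      ‖(p : CompletedAlgClosure F) ^ d * PowerSeries.coeff n
        ((W.map ((CBall F).subtype.comp (EisensteinRoot.CoeffDisc.toCBall D))).formalLog -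
          PowerSeries.C (∑ i : Fin D.e, algebraMap F (CompletedAlgClosure F) (algebraMap (PadicBase F p hp) F (a i)) *
              ((D.rootC : integerC F) : CompletedAlgClosure F) ^ (i : ℕ)) *
            (E₀.map (Int.castRingHom (CompletedAlgClosure F))).formalLog -
          PowerSeries.C (∑ i : Fin D.e, algebraMap F (CompletedAlgClosure F) (algebraMap (PadicBase F p hp) F (b i)) *
              ((D.rootC : integerC F) : CompletedAlgClosure F) ^ (i : ℕ)) *
            PowerSeries.expand p hpp.out.ne_zero (E₀.map (Int.castRingHom (CompletedAlgClosure F))).formalLog)‖ ≤ 1 := by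
  obtain ⟨ℓ, h0, hlt, hlog, hcoc⟩ := exists_coords_formalLog_secondKind D W E₀ hWE hM0 hM
  obtain ⟨d', hd'⟩ := exists_le_norm_p_zpow_neg hp (M / ‖(p : CompletedAlgClosure F)‖)
  -- the two avatars of `ℚ_p` and of `F_{E₀}`, `log_{E₀}`
  set τ : PadicBase F p hp →+* ℚ_[p] := (PadicBase.toPadic hp : PadicBase F p hp →+* ℚ_[p]) with hτ
  have hτapply : ∀ x, τ x = PadicBase.toPadic hp x := fun x => rfl
  have hτint : τ.comp (Int.castRingHom (PadicBase F p hp)) = Int.castRingHom ℚ_[p] := RingHom.ext_int _ _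
  set ιh : PadicBase F p hp →+* CompletedAlgClosure F := (algebraMap F (CompletedAlgClosure F)).comp (algebraMap (PadicBase F p hp) F)
    with hιh
  have hιapply : ∀ x, ιh x = algebraMap F (CompletedAlgClosure F) (algebraMap (PadicBase F p hp) F x) := fun x => rfl
  have hιint : ιh.comp (Int.castRingHom (PadicBase F p hp)) = Int.castRingHom (CompletedAlgClosure F) := RingHom.ext_int _ _
  have hV : (E₀.map (Int.castRingHom ℤ_[p])).map PadicInt.Coe.ringHom = E₀.map (Int.castRingHom ℚ_[p]) := by
    rw [WeierstrassCurve.map_map]; congr 1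
  have hFG : MvPowerSeries.map τ (E₀.map (Int.castRingHom (PadicBase F p hp))).formalGroupLaw =
      ((E₀.map (Int.castRingHom ℤ_[p])).map PadicInt.Coe.ringHom).formalGroupLaw := by
    rw [hV, ← WeierstrassCurve.map_formalGroupLaw, ← WeierstrassCurve.map_formalGroupLaw, MvPowerSeries.map_map, hτint]
  have hLOG : PowerSeries.map τ (E₀.map (Int.castRingHom (PadicBase F p hp))).formalLog =
      ((E₀.map (Int.castRingHom ℤ_[p])).map PadicInt.Coe.ringHom).formalLog := by
    rw [hV, WeierstrassCurve.map_formalLog, WeierstrassCurve.map_map, hτint]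
  have hLOGC : PowerSeries.map ιh (E₀.map (Int.castRingHom (PadicBase F p hp))).formalLog =
      (E₀.map (Int.castRingHom (CompletedAlgClosure F))).formalLog := by
    rw [WeierstrassCurve.map_formalLog, WeierstrassCurve.map_map, hιint]
  -- Katz's rank theorem, coordinate by coordinate
  have hkatz : ∀ i : Fin D.e, ∃ (a b : ℚ_[p]) (d'' : ℕ), ∀ n : ℕ, ‖(p : ℚ_[p]) ^ d'' * PowerSeries.coeff n
      (PowerSeries.map τ (ℓ i) - PowerSeries.C a * ((E₀.map (Int.castRingHom ℤ_[p])).map PadicInt.Coe.ringHom).formalLog -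
        PowerSeries.C b * PowerSeries.expand p hpp.out.ne_zero ((E₀.map (Int.castRingHom ℤ_[p])).map PadicInt.Coe.ringHom).formalLog)‖ ≤ 1 := by
    intro i
    refine KatzRankAllFibres.padicRankTwo (E₀.map (Int.castRingHom ℤ_[p])) hp2 (PowerSeries.map τ (ℓ i)) ?_ ⟨0, fun n => ?_⟩
      ⟨d', fun e => ?_⟩
    · rw [← PowerSeries.coeff_zero_eq_constantCoeff_apply, PowerSeries.coeff_map, PowerSeries.coeff_zero_eq_constantCoeff_apply, h0 i, map_zero]
    · rw [pow_zero, one_mul, PowerSeries.coeff_map, ← map_natCast τ, ← map_mul, hτapply]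
      exact (PadicBase.norm_le_one_iff hp _).mp (hlt i n)
    · have hs : PowerSeries.HasSubst (E₀.map (Int.castRingHom (PadicBase F p hp))).formalGroupLaw :=
        PowerSeries.HasSubst.of_constantCoeff_zero (E₀.map (Int.castRingHom (PadicBase F p hp))).constantCoeff_formalGroupLaw
      have hsX0 : PowerSeries.HasSubst (MvPowerSeries.X 0 : MvPowerSeries (Fin 2) (PadicBase F p hp)) :=
        PowerSeries.HasSubst.of_constantCoeff_zero (MvPowerSeries.constantCoeff_X 0)
      have hsX1 : PowerSeries.HasSubst (MvPowerSeries.X 1 : MvPowerSeries (Fin 2) (PadicBase F p hp)) :=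
        PowerSeries.HasSubst.of_constantCoeff_zero (MvPowerSeries.constantCoeff_X 1)
      have hΛ : (PowerSeries.map τ (ℓ i)).subst ((E₀.map (Int.castRingHom ℤ_[p])).map PadicInt.Coe.ringHom).formalGroupLaw -
          (PowerSeries.map τ (ℓ i)).subst (MvPowerSeries.X 0 : MvPowerSeries (Fin 2) ℚ_[p]) -
          (PowerSeries.map τ (ℓ i)).subst (MvPowerSeries.X 1 : MvPowerSeries (Fin 2) ℚ_[p]) =
          MvPowerSeries.map τ ((ℓ i).subst (E₀.map (Int.castRingHom (PadicBase F p hp))).formalGroupLaw -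
            (ℓ i).subst (MvPowerSeries.X 0 : MvPowerSeries (Fin 2) (PadicBase F p hp)) -
            (ℓ i).subst (MvPowerSeries.X 1 : MvPowerSeries (Fin 2) (PadicBase F p hp))) := by
        symm
        rw [map_sub, map_sub, PowerSeries.map_subst hs, PowerSeries.map_subst hsX0, PowerSeries.map_subst hsX1, hFG,
          MvPowerSeries.map_X, MvPowerSeries.map_X]
      rw [hΛ, MvPowerSeries.coeff_map, hτapply]
      exact norm_pow_mul_toPadic_le_one_of_norm_le hp _ d' ((hcoc i e).trans hd')
  choose a b dd hdd using hkatz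
  refine ⟨fun i => (PadicBase.toPadic hp).symm (a i), fun i => (PadicBase.toPadic hp).symm (b i), ∑ i, dd i, fun n => ?_⟩
  -- the remainders `hᵢ = ℓᵢ − aᵢ log − bᵢ log(Xᵖ)` over `K₀`
  set L0 : PowerSeries (PadicBase F p hp) := (E₀.map (Int.castRingHom (PadicBase F p hp))).formalLog with hL0
  set h : Fin D.e → PowerSeries (PadicBase F p hp) := fun i => ℓ i - PowerSeries.C ((PadicBase.toPadic hp).symm (a i)) * L0 -
    PowerSeries.C ((PadicBase.toPadic hp).symm (b i)) * PowerSeries.expand p hpp.out.ne_zero L0 with hh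
  have hrem : ∀ i (m : ℕ), ‖(p : PadicBase F p hp) ^ dd i * PowerSeries.coeff m (h i)‖ ≤ 1 := by
    intro i m
    refine (PadicBase.norm_le_one_iff hp _).mpr ?_
    have hmap : PowerSeries.map τ (h i) =
        PowerSeries.map τ (ℓ i) - PowerSeries.C (a i) * ((E₀.map (Int.castRingHom ℤ_[p])).map PadicInt.Coe.ringHom).formalLog -
          PowerSeries.C (b i) * PowerSeries.expand p hpp.out.ne_zero ((E₀.map (Int.castRingHom ℤ_[p])).map PadicInt.Coe.ringHom).formalLog := by
      rw [hh]
      simp only [map_sub, map_mul, PowerSeries.map_C, PowerSeries.map_expand, hLOG, hτapply, RingEquiv.apply_symm_apply]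
    have h1 := hdd i m
    rw [← hmap, PowerSeries.coeff_map, ← map_natCast τ, ← map_pow, ← map_mul, hτapply] at h1
    exact h1
  have hrem' : ∀ i (m : ℕ), ‖(p : PadicBase F p hp) ^ (∑ j, dd j) * PowerSeries.coeff m (h i)‖ ≤ 1 := by
    intro i m
    have hle : dd i ≤ ∑ j, dd j := Finset.single_le_sum (fun j _ => Nat.zero_le (dd j)) (Finset.mem_univ i)
    obtain ⟨k, hk⟩ := Nat.exists_eq_add_of_le hle
    rw [hk, pow_add, mul_comm ((p : PadicBase F p hp) ^ dd i), mul_assoc, norm_mul]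
    refine mul_le_one₀ ?_ (norm_nonneg _) (hrem i m)
    rw [norm_pow]; exact pow_le_one₀ (norm_nonneg _) (PadicBase.norm_p_lt_one hp).le
  -- the coefficient identity in `ℂ_F`
  have hℓi : ∀ i, PowerSeries.coeff n (ℓ i) = PowerSeries.coeff n (h i) + (PadicBase.toPadic hp).symm (a i) * PowerSeries.coeff n L0 +
      (PadicBase.toPadic hp).symm (b i) * PowerSeries.coeff n (PowerSeries.expand p hpp.out.ne_zero L0) := by
    intro i
    rw [hh]
    simp only [map_sub, PowerSeries.coeff_C_mul]
    ring
  have hL0n : ιh (PowerSeries.coeff n L0) = PowerSeries.coeff n (E₀.map (Int.castRingHom (CompletedAlgClosure F))).formalLog := by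
    rw [← PowerSeries.coeff_map, hLOGC]
  have hL0pn : ιh (PowerSeries.coeff n (PowerSeries.expand p hpp.out.ne_zero L0)) =
      PowerSeries.coeff n (PowerSeries.expand p hpp.out.ne_zero (E₀.map (Int.castRingHom (CompletedAlgClosure F))).formalLog) := by
    rw [← PowerSeries.coeff_map, PowerSeries.map_expand, hLOGC]
  have hlogn : PowerSeries.coeff n (W.map ((CBall F).subtype.comp (EisensteinRoot.CoeffDisc.toCBall D))).formalLog =
      ∑ i : Fin D.e, ((D.rootC : integerC F) : CompletedAlgClosure F) ^ (i : ℕ) * ιh (PowerSeries.coeff n (ℓ i)) := by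
    rw [hlog, map_sum]
    refine Finset.sum_congr rfl fun i _ => ?_
    rw [PowerSeries.coeff_C_mul, PowerSeries.coeff_map]
  have hcoef : PowerSeries.coeff n
      ((W.map ((CBall F).subtype.comp (EisensteinRoot.CoeffDisc.toCBall D))).formalLog -
        PowerSeries.C (∑ i : Fin D.e, algebraMap F (CompletedAlgClosure F) (algebraMap (PadicBase F p hp) F
            ((fun i => (PadicBase.toPadic hp).symm (a i)) i)) * ((D.rootC : integerC F) : CompletedAlgClosure F) ^ (i : ℕ)) *
          (E₀.map (Int.castRingHom (CompletedAlgClosure F))).formalLog -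
        PowerSeries.C (∑ i : Fin D.e, algebraMap F (CompletedAlgClosure F) (algebraMap (PadicBase F p hp) F
            ((fun i => (PadicBase.toPadic hp).symm (b i)) i)) * ((D.rootC : integerC F) : CompletedAlgClosure F) ^ (i : ℕ)) *
          PowerSeries.expand p hpp.out.ne_zero (E₀.map (Int.castRingHom (CompletedAlgClosure F))).formalLog) =
      ∑ i : Fin D.e, ((D.rootC : integerC F) : CompletedAlgClosure F) ^ (i : ℕ) * ιh (PowerSeries.coeff n (h i)) := by
    simp only [map_sub, PowerSeries.coeff_C_mul, hlogn, hℓi, map_add, map_mul, ← hιapply, ← hL0n, ← hL0pn, Finset.sum_mul,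
      ← Finset.sum_sub_distrib]
    refine Finset.sum_congr rfl fun i _ => ?_
    ring
  -- conclusion: `‖p^d Σ ϖⁱ ι(cᵢ)‖ ≤ max ‖ι(p^d cᵢ)‖ ≤ 1`
  rw [hcoef, Finset.mul_sum]
  refine IsUltrametricDist.norm_sum_le_of_forall_le_of_nonneg zero_le_one fun i _ => ?_
  rw [mul_left_comm, norm_mul]
  refine mul_le_one₀ ?_ (norm_nonneg _) ?_
  · rw [norm_pow]; exact pow_le_one₀ (norm_nonneg _) D.norm_rootC_lt_one.le
  · rw [← map_natCast ιh, ← map_pow, ← map_mul, hιapply, norm_iota]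
    exact hrem' i n

end Summit.BirchSwinnertonDyer.BirchSwinnertonDyer.Theorems.TransportedHodgeLine
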